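import Literature.ModelTheory.FiniteModelTheory.SparseOrInstance
import Literature.Computability.Complexity.KarpChromaticGraph
import HarnessLib

/-!
# `3SAT ≤ CSP(OR_⊥(𝔽₂-equations, 𝔽₃-equations))`: the gadget structure and its correctness

Topic `Literature/ModelTheory/FiniteModelTheory`; the combinatorial half of the NP-hardness of
`cspLanguage lpTemplate` in the discharge of `LichterPago2025_cohomologyFooled`
(`CohomologicalConsistencyLimits.lean`).  Lichter–Pago (arXiv:2407.09097, Lemmas 3.18–3.19) show that
the intractable OR-construction of two templates is NP-complete by a reduction from MONOTONE 3-SAT: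
an element may ESCAPE to the fresh value `c_i` of its sort, a tuple of an honestly unsatisfiable
family of constraints inside one sort forces one of its elements to escape, and the link relation
`S` forbids an element of sort 1 and an element of sort 2 to escape simultaneously.  We reduce
directly from `3SAT` in the slot format of `KarpChromaticGraph.lean` (`r` clauses, three literal slots
per clause, `L : Fin r × Fin 3 → Literal ℕ`): the structure `LPRed.gadget L` on the `12r` elements
`Kind × (Fin r × Fin 3)` has

* `e⁺_p = (pos, p)` (sort 1) and `e⁻_p = (neg, p)` (sort 2) for every slot `p`, linked (`S`)
  whenever `p, q` carry the same variable — "`x` true" is "`e⁺` escapes", "`x` false" is "`e⁻`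
  escapes";
* clause selectors `w⁺_i = (v, (i, 0))` (sort 1), `w⁻_i = (cl, (i, 0))` (sort 2), linked;
* for every clause `i` the ternary constraints `R¹₀ ∧ R¹₁` (jointly honestly unsatisfiable over
  `𝔽₂`) on the tuple `(p_{i,0}, p_{i,1}, p_{i,2})`, `p_{i,t} = e⁺_{(i,t)}` for a positive slot and
  `w⁺_i` for a negative one, and `R²₀ ∧ R²₁ ∧ R²₂` on the mirror tuple of `e⁻`'s of negative slots and
  `w⁻_i` (sort 2).

Main result `LPRed.nonempty_hom_iff`: `(Kind × Slot r, gadget L) → OR_⊥` exists iff some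
assignment makes a slot literal of every clause true; `LPRed.slotSat_iff_satisfiable` identifies the
latter with satisfiability for CNFs of width `≤ 3` without empty clauses (`KarpChromatic.slotLit`).

## References

* [LichterPago2025] M. Lichter, B. Pago, arXiv:2407.09097, Lemmas 3.18–3.19 (NP-completeness of the
  intractable OR-construction, from monotone 3-SAT).
* [Karp1972] R. M. Karp, *Reducibility among combinatorial problems*, §4 (SATISFIABILITY WITH AT
  MOST 3 LITERALS PER CLAUSE; the slot format is that of `KarpChromaticGraph.lean`).
-/

namespace Literature.ModelTheory.FiniteModelTheory

open FirstOrder FirstOrder.Language FirstOrder.Language.Structure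
open Literature.Computability.Complexity Literature.Computability.Complexity.KarpChromatic

namespace LPRed

variable {r : ℕ}

/-- The sort-1 tuple of clause `i`: `e⁺` of a positive slot, the selector `w⁺_i` for a negative one.
[cite: LichterPago2025, Lemma 3.18 (proof: the triple of a positive clause)] -/
def tuple₁ (L : Slot r → Literal ℕ) (i : Fin r) : Fin 3 → Vtx r :=
  fun t => if (L (i, t)).2 = true then (Kind.pos, (i, t)) else (Kind.v, (i, 0))

/-- The sort-2 tuple of clause `i`: `e⁻` of a negative slot, the selector `w⁻_i` for a positive one.
[cite: LichterPago2025, Lemma 3.18 (proof: the triple of a negative clause)] -/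
def tuple₂ (L : Slot r → Literal ℕ) (i : Fin r) : Fin 3 → Vtx r :=
  fun t => if (L (i, t)).2 = false then (Kind.neg, (i, t)) else (Kind.cl, (i, 0))

/-- The link relation: `(e⁺_p, e⁻_q)` for slots with the same variable, and `(w⁺_i, w⁻_i)`.
[cite: LichterPago2025, Lemma 3.18 (proof: the pairs (x, x̄) in S)] -/
def LinkRel (L : Slot r → Literal ℕ) (a b : Vtx r) : Prop :=
  (∃ p q : Slot r, a = (Kind.pos, p) ∧ b = (Kind.neg, q) ∧ (L p).1 = (L q).1) ∨
    ∃ i : Fin r, a = (Kind.v, (i, 0)) ∧ b = (Kind.cl, (i, 0))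

/-- **The gadget structure** of a family of slot literals, an `orLinLanguage`-structure on
`Kind × Slot r`. [cite: LichterPago2025, Lemmas 3.18–3.19] -/
@[reducible] def gadget (L : Slot r → Literal ℕ) : orLinLanguage.Structure (Vtx r) where
  RelMap := fun {n} R x =>
    match n, R, x with
    | _, OrRel.inl (LinRel.eq _), x => ∃ i : Fin r, x = tuple₁ L i
    | _, OrRel.inr (LinRel.eq _), x => ∃ i : Fin r, x = tuple₂ L i
    | _, OrRel.link, x => LinkRel L (x 0) (x 1)

/-- "Slot-satisfiable": some assignment makes a slot literal of every clause true. [folklore] -/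
def SlotSat (L : Slot r → Literal ℕ) : Prop :=
  ∃ σ : ℕ → Bool, ∀ i : Fin r, ∃ t : Fin 3, (L (i, t)).eval σ = true

/-! ### From an assignment to a homomorphism -/

section Completeness

variable (L : Slot r → Literal ℕ) (σ : ℕ → Bool)

/-- Some positive slot of clause `i` is true under `σ`. [folklore] -/
def PosTrue (i : Fin r) : Prop := ∃ t : Fin 3, (L (i, t)).2 = true ∧ σ (L (i, t)).1 = true

/-- **The homomorphism of a satisfying assignment**: `e⁺_p` escapes iff its variable is true, `e⁻_p`
iff it is false, `w⁻_i` iff some positive slot of clause `i` is true, `w⁺_i` otherwise; honest values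
`0`. [cite: LichterPago2025, Lemma 3.18 (proof, the map g of a satisfying assignment)] -/
noncomputable def homMap (x : Vtx r) : OrLinTemplate :=
  open scoped Classical in
  match x.1 with
  | Kind.pos => if σ (L x.2).1 = true then Sum.inl none else Sum.inl (some 0)
  | Kind.neg => if σ (L x.2).1 = true then Sum.inr (some 0) else Sum.inr none
  | Kind.v => if PosTrue L σ x.2.1 then Sum.inl (some 0) else Sum.inl none
  | Kind.cl => if PosTrue L σ x.2.1 then Sum.inr none else Sum.inr (some 0)

variable {L σ}

/-- `e⁺_p` is in sort 1; it escapes iff its variable is true. [folklore] -/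
theorem homMap_pos (p : Slot r) :
    homMap L σ (Kind.pos, p) = if σ (L p).1 = true then Sum.inl none else Sum.inl (some 0) := rfl

/-- `e⁻_p` is in sort 2; it escapes iff its variable is false. [folklore] -/
theorem homMap_neg (p : Slot r) :
    homMap L σ (Kind.neg, p) = if σ (L p).1 = true then Sum.inr (some 0) else Sum.inr none := rfl

open scoped Classical in
/-- `w⁺_i` (any copy) is in sort 1; it escapes iff no positive slot of clause `i` is true. [folklore] -/
theorem homMap_v (i : Fin r) (j : Fin 3) :
    homMap L σ (Kind.v, (i, j)) = if PosTrue L σ i then Sum.inl (some 0) else Sum.inl none := rfl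

open scoped Classical in
/-- `w⁻_i` (any copy) is in sort 2; it escapes iff some positive slot of clause `i` is true. [folklore] -/
theorem homMap_cl (i : Fin r) (j : Fin 3) :
    homMap L σ (Kind.cl, (i, j)) = if PosTrue L σ i then Sum.inr none else Sum.inr (some 0) := rfl

/-- Entries of the sort-1 tuple are in sort 1. [folklore] -/
theorem homMap_tuple₁ (i : Fin r) (t : Fin 3) : ∃ o, homMap L σ (tuple₁ L i t) = Sum.inl o := by
  classical
  unfold tuple₁
  split_ifs
  · rw [homMap_pos]; split_ifs <;> exact ⟨_, rfl⟩
  · rw [homMap_v]; split_ifs <;> exact ⟨_, rfl⟩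

/-- Entries of the sort-2 tuple are in sort 2. [folklore] -/
theorem homMap_tuple₂ (i : Fin r) (t : Fin 3) : ∃ o, homMap L σ (tuple₂ L i t) = Sum.inr o := by
  classical
  unfold tuple₂
  split_ifs
  · rw [homMap_neg]; split_ifs <;> exact ⟨_, rfl⟩
  · rw [homMap_cl]; split_ifs <;> exact ⟨_, rfl⟩

/-- The sort-1 tuple of a satisfied clause has an escape. [cite: LichterPago2025, Lemma 3.18 (proof)] -/
theorem exists_escape_tuple₁ (i : Fin r) (hsat : ∃ t : Fin 3, (L (i, t)).eval σ = true) :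
    ∃ t, homMap L σ (tuple₁ L i t) = Sum.inl none := by
  classical
  by_cases hpos : PosTrue L σ i
  · obtain ⟨t, hpol, hσ⟩ := hpos
    refine ⟨t, ?_⟩
    rw [tuple₁, if_pos hpol, homMap_pos, if_pos hσ]
  · -- a negative slot exists (otherwise the true slot would be positive): it carries `w⁺_i`
    obtain ⟨t, ht⟩ := hsat
    have hpol : (L (i, t)).2 = false := by
      by_contra h
      rw [Bool.not_eq_false] at h
      refine hpos ⟨t, h, ?_⟩
      simpa [Literal.eval, h] using ht
    refine ⟨t, ?_⟩
    rw [tuple₁, if_neg (by rw [hpol]; exact Bool.false_ne_true), homMap_v, if_neg hpos]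

/-- The sort-2 tuple of a satisfied clause has an escape. [cite: LichterPago2025, Lemma 3.18 (proof)] -/
theorem exists_escape_tuple₂ (i : Fin r) (hsat : ∃ t : Fin 3, (L (i, t)).eval σ = true) :
    ∃ t, homMap L σ (tuple₂ L i t) = Sum.inr none := by
  classical
  by_cases hpos : PosTrue L σ i
  · have hpos' := hpos
    obtain ⟨t, hpol, -⟩ := hpos'
    refine ⟨t, ?_⟩
    have hne : ¬ (L (i, t)).2 = false := by rw [hpol]; decide
    rw [tuple₂, if_neg hne, homMap_cl, if_pos hpos]
  · obtain ⟨t, ht⟩ := hsat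
    have hpol : (L (i, t)).2 = false := by
      by_contra h
      rw [Bool.not_eq_false] at h
      refine hpos ⟨t, h, ?_⟩
      simpa [Literal.eval, h] using ht
    have hσ : ¬ σ (L (i, t)).1 = true := by
      have : σ (L (i, t)).1 = false := by simpa [Literal.eval, hpol] using ht
      rw [this]; exact Bool.false_ne_true
    refine ⟨t, ?_⟩
    rw [tuple₂, if_pos hpol, homMap_neg, if_neg hσ]

/-- **A satisfying assignment gives a homomorphism to `OR_⊥`.** [cite: LichterPago2025, Lemma 3.18 (proof, ⇐)] -/
theorem nonempty_hom_of_slotSat (h : SlotSat L) :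
    Nonempty (@FirstOrder.Language.Hom orLinLanguage (Vtx r) OrLinTemplate (gadget L) _) := by
  classical
  obtain ⟨σ, hσ⟩ := h
  refine ⟨@FirstOrder.Language.Hom.mk orLinLanguage (Vtx r) OrLinTemplate (gadget L) _ (homMap L σ)
    (fun {n} f => isEmptyElim f) ?_⟩
  intro n R x hx
  match n, R, x, hx with
  | _, OrRel.inl (LinRel.eq c), x, hx =>
    obtain ⟨i, rfl⟩ := hx
    choose o ho using fun t => homMap_tuple₁ (L := L) (σ := σ) i t
    obtain ⟨t, ht⟩ := exists_escape_tuple₁ i (hσ i)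
    refine (OrTemplate.relMap_inl (L₁ := linLanguage 2) (L₂ := linLanguage 3) (A₁ := ZMod 2)
      (A₂ := ZMod 3) (show (linLanguage 2).Relations 3 from LinRel.eq c) _).2 ⟨o, fun t => ho t, ?_⟩
    refine Or.inr (Or.inl ⟨t, ?_⟩)
    have := (ho t).symm.trans ht
    exact Sum.inl_injective this
  | _, OrRel.inr (LinRel.eq c), x, hx =>
    obtain ⟨i, rfl⟩ := hx
    choose o ho using fun t => homMap_tuple₂ (L := L) (σ := σ) i t
    obtain ⟨t, ht⟩ := exists_escape_tuple₂ i (hσ i)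
    refine (OrTemplate.relMap_inr (L₁ := linLanguage 2) (L₂ := linLanguage 3) (A₁ := ZMod 2)
      (A₂ := ZMod 3) (show (linLanguage 3).Relations 3 from LinRel.eq c) _).2 ⟨o, fun t => ho t, ?_⟩
    refine Or.inr (Or.inl ⟨t, ?_⟩)
    have := (ho t).symm.trans ht
    exact Sum.inr_injective this
  | _, OrRel.link, x, hx =>
    refine (OrTemplate.relMap_link (L₁ := linLanguage 2) (L₂ := linLanguage 3) _).2 ?_
    change (∃ (a : ZMod 2) (o : Option (ZMod 3)), homMap L σ (x 0) = OrTemplate.inl (some a) ∧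
        homMap L σ (x 1) = OrTemplate.inr o) ∨
      ∃ (o : Option (ZMod 2)) (a : ZMod 3), homMap L σ (x 0) = OrTemplate.inl o ∧
        homMap L σ (x 1) = OrTemplate.inr (some a)
    rcases hx with ⟨p, q, h0, h1, hpq⟩ | ⟨i, h0, h1⟩
    · rw [h0, h1, homMap_pos, homMap_neg, ← hpq]
      by_cases hv : σ (L p).1 = true
      · right; exact ⟨none, 0, by rw [if_pos hv]; rfl, by rw [if_pos hv]; rfl⟩
      · left; exact ⟨0, none, by rw [if_neg hv]; rfl, by rw [if_neg hv]; rfl⟩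
    · rw [h0, h1, homMap_v, homMap_cl]
      by_cases hp : PosTrue L σ i
      · left; exact ⟨0, none, by rw [if_pos hp]; rfl, by rw [if_pos hp]; rfl⟩
      · right; exact ⟨none, 0, by rw [if_neg hp]; rfl, by rw [if_neg hp]; rfl⟩

end Completeness

/-! ### From a homomorphism to an assignment -/

section Soundness

variable {L : Slot r → Literal ℕ}
variable (F : @FirstOrder.Language.Hom orLinLanguage (Vtx r) OrLinTemplate (gadget L) _)
include F

/-- The two sort-1 constraints of a clause force an escape in its sort-1 tuple (the honest sums would
be `0` and `1` at once). [cite: LichterPago2025, Lemma 3.18 (proof, ⇒: R₁-tuples contain an escape)] -/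
theorem exists_tuple₁_eq_none (i : Fin r) : ∃ t, F (tuple₁ L i t) = Sum.inl none := by
  have h0 : @RelMap orLinLanguage (Vtx r) (gadget L) 3 (OrRel.inl (LinRel.eq 0)) (tuple₁ L i) :=
    ⟨i, rfl⟩
  have h1 : @RelMap orLinLanguage (Vtx r) (gadget L) 3 (OrRel.inl (LinRel.eq 1)) (tuple₁ L i) :=
    ⟨i, rfl⟩
  have g0 := @FirstOrder.Language.Hom.map_rel orLinLanguage (Vtx r) OrLinTemplate (gadget L) _ F 3 _ _ h0
  have g1 := @FirstOrder.Language.Hom.map_rel orLinLanguage (Vtx r) OrLinTemplate (gadget L) _ F 3 _ _ h1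
  obtain ⟨y0, hy0, hc0⟩ := (OrTemplate.relMap_inl (L₁ := linLanguage 2) (L₂ := linLanguage 3)
    (A₁ := ZMod 2) (A₂ := ZMod 3) (show (linLanguage 2).Relations 3 from LinRel.eq 0) _).1 g0
  obtain ⟨y1, hy1, hc1⟩ := (OrTemplate.relMap_inl (L₁ := linLanguage 2) (L₂ := linLanguage 3)
    (A₁ := ZMod 2) (A₂ := ZMod 3) (show (linLanguage 2).Relations 3 from LinRel.eq 1) _).1 g1
  have hy : y0 = y1 := funext fun t => Sum.inl_injective ((hy0 t).symm.trans (hy1 t))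
  subst hy
  rcases hc0 with hall | ⟨t, ht⟩ | ⟨z, hz, hsum0⟩
  · exact ⟨0, by rw [show F (tuple₁ L i 0) = _ from hy0 0, hall 0]; rfl⟩
  · exact ⟨t, by rw [show F (tuple₁ L i t) = _ from hy0 t, ht]; rfl⟩
  · exfalso
    rcases hc1 with hall | ⟨t, ht⟩ | ⟨z', hz', hsum1⟩
    · have := (hz 0).symm.trans (hall 0); cases this
    · have := (hz t).symm.trans ht; cases this
    · have hzz : z = z' := funext fun t => Option.some_injective _ ((hz t).symm.trans (hz' t))
      subst hzz
      have : (0 : ZMod 2) = 1 := hsum0.symm.trans hsum1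
      exact absurd this (by decide)

/-- The sort-2 constraints of a clause force an escape in its sort-2 tuple.
[cite: LichterPago2025, Lemma 3.18 (proof, ⇒: R₂-tuples contain an escape)] -/
theorem exists_tuple₂_eq_none (i : Fin r) : ∃ t, F (tuple₂ L i t) = Sum.inr none := by
  have h0 : @RelMap orLinLanguage (Vtx r) (gadget L) 3 (OrRel.inr (LinRel.eq 0)) (tuple₂ L i) :=
    ⟨i, rfl⟩
  have h1 : @RelMap orLinLanguage (Vtx r) (gadget L) 3 (OrRel.inr (LinRel.eq 1)) (tuple₂ L i) :=
    ⟨i, rfl⟩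
  have g0 := @FirstOrder.Language.Hom.map_rel orLinLanguage (Vtx r) OrLinTemplate (gadget L) _ F 3 _ _ h0
  have g1 := @FirstOrder.Language.Hom.map_rel orLinLanguage (Vtx r) OrLinTemplate (gadget L) _ F 3 _ _ h1
  obtain ⟨y0, hy0, hc0⟩ := (OrTemplate.relMap_inr (L₁ := linLanguage 2) (L₂ := linLanguage 3)
    (A₁ := ZMod 2) (A₂ := ZMod 3) (show (linLanguage 3).Relations 3 from LinRel.eq 0) _).1 g0
  obtain ⟨y1, hy1, hc1⟩ := (OrTemplate.relMap_inr (L₁ := linLanguage 2) (L₂ := linLanguage 3)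
    (A₁ := ZMod 2) (A₂ := ZMod 3) (show (linLanguage 3).Relations 3 from LinRel.eq 1) _).1 g1
  have hy : y0 = y1 := funext fun t => Sum.inr_injective ((hy0 t).symm.trans (hy1 t))
  subst hy
  rcases hc0 with hall | ⟨t, ht⟩ | ⟨z, hz, hsum0⟩
  · exact ⟨0, by rw [show F (tuple₂ L i 0) = _ from hy0 0, hall 0]; rfl⟩
  · exact ⟨t, by rw [show F (tuple₂ L i t) = _ from hy0 t, ht]; rfl⟩
  · exfalso
    rcases hc1 with hall | ⟨t, ht⟩ | ⟨z', hz', hsum1⟩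
    · have := (hz 0).symm.trans (hall 0); cases this
    · have := (hz t).symm.trans ht; cases this
    · have hzz : z = z' := funext fun t => Option.some_injective _ ((hz t).symm.trans (hz' t))
      subst hzz
      have : (0 : ZMod 3) = 1 := hsum0.symm.trans hsum1
      exact absurd this (by decide)

/-- A link never carries two escapes. [cite: LichterPago2025, Lemma 3.18 (proof: S forbids (c₁,c₂))] -/
theorem not_both_none {a b : Vtx r} (hab : LinkRel L a b) (ha : F a = Sum.inl none)
    (hb : F b = Sum.inr none) : False := by
  have h : @RelMap orLinLanguage (Vtx r) (gadget L) 2 OrRel.link ![a, b] := hab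
  have g := @FirstOrder.Language.Hom.map_rel orLinLanguage (Vtx r) OrLinTemplate (gadget L) _ F 2 _ _ h
  rcases (OrTemplate.relMap_link (L₁ := linLanguage 2) (L₂ := linLanguage 3) _).1 g with
    ⟨a', o, h0, -⟩ | ⟨o, a', -, h1⟩
  · have : F a = OrTemplate.inl (some a') := h0
    rw [ha] at this; cases this
  · have : F b = OrTemplate.inr (some a') := h1
    rw [hb] at this; cases this

/-- **A homomorphism to `OR_⊥` gives a satisfying assignment**: `x ↦ [some e⁺ of a slot carrying x
escapes]`. [cite: LichterPago2025, Lemma 3.18 (proof, ⇒)] -/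
theorem slotSat_of_hom : SlotSat L := by
  classical
  refine ⟨fun x => decide (∃ p : Slot r, (L p).1 = x ∧ F (Kind.pos, p) = Sum.inl none), fun i => ?_⟩
  obtain ⟨t, ht⟩ := exists_tuple₁_eq_none F i
  by_cases hpol : (L (i, t)).2 = true
  · -- a positive slot escapes: its variable is true
    refine ⟨t, ?_⟩
    have hesc : F (Kind.pos, (i, t)) = Sum.inl none := by simpa [tuple₁, hpol] using ht
    simp only [Literal.eval, hpol, beq_true, decide_eq_true_eq]
    exact ⟨(i, t), rfl, hesc⟩
  · -- the selector `w⁺_i` escapes, so `w⁻_i` is honest and a negative slot escapes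
    rw [Bool.not_eq_true] at hpol
    have hw : F (Kind.v, (i, 0)) = Sum.inl none := by simpa [tuple₁, hpol] using ht
    obtain ⟨t', ht'⟩ := exists_tuple₂_eq_none F i
    have hpol' : (L (i, t')).2 = false := by
      by_contra h
      rw [Bool.not_eq_false] at h
      have hcl : F (Kind.cl, (i, 0)) = Sum.inr none := by simpa [tuple₂, h] using ht'
      exact not_both_none F (Or.inr ⟨i, rfl, rfl⟩) hw hcl
    have hesc : F (Kind.neg, (i, t')) = Sum.inr none := by simpa [tuple₂, hpol'] using ht'
    refine ⟨t', ?_⟩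
    simp only [Literal.eval, hpol', beq_false, Bool.not_eq_true', decide_eq_false_iff_not, not_exists,
      not_and]
    intro p hp hesc'
    exact not_both_none F (Or.inl ⟨p, (i, t'), rfl, rfl, hp⟩) hesc' hesc

end Soundness

/-- **Correctness of the gadget structure**: a homomorphism to `OR_⊥` exists iff some assignment
makes a slot literal of every clause true. [cite: LichterPago2025, Lemmas 3.18–3.19] -/
theorem nonempty_hom_iff (L : Slot r → Literal ℕ) :
    Nonempty (@FirstOrder.Language.Hom orLinLanguage (Vtx r) OrLinTemplate (gadget L) _) ↔
      SlotSat L :=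
  ⟨fun ⟨F⟩ => slotSat_of_hom F, nonempty_hom_of_slotSat⟩

/-- **Slot-satisfiability is satisfiability** for CNFs of width `≤ 3` without empty clauses
(`KarpChromatic.slotLit`: every slot literal is a literal of its clause, and a true clause has a true
slot literal). [cite: Karp1972, §4 (SATISFIABILITY WITH AT MOST 3 LITERALS PER CLAUSE)] -/
theorem slotSat_iff_satisfiable (φ : CNF ℕ) (hw : φ.IsWidthLE 3) (hne : ([] : Clause ℕ) ∉ φ) :
    SlotSat (slotLit φ) ↔ φ.Satisfiable := by
  have hne' : ∀ i : Fin φ.length, φ[i] ≠ [] := fun i h => hne (h ▸ List.getElem_mem i.2)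
  constructor
  · rintro ⟨σ, hσ⟩
    refine ⟨σ, (CNF.eval_eq_true_iff φ σ).2 fun c hc => ?_⟩
    obtain ⟨i, hi, rfl⟩ := List.getElem_of_mem hc
    obtain ⟨t, ht⟩ := hσ ⟨i, hi⟩
    have hmem := (slotLit_spec φ ⟨i, hi⟩ (hne' ⟨i, hi⟩)).1 t
    simp only [Clause.eval, List.any_eq_true]
    exact ⟨_, hmem, ht⟩
  · rintro ⟨σ, hσ⟩
    exact ⟨σ, fun i => (slotLit_spec φ i (hne' i)).2 σ (hw _ (List.getElem_mem i.2))
      ((CNF.eval_eq_true_iff φ σ).1 hσ _ (List.getElem_mem i.2))⟩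

end LPRed

end Literature.ModelTheory.FiniteModelTheory
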